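import Summits.FinalStateConjecture.FinalStateConjecture.Theses.TemporalBandLiouville

/-! Strategist q1 certificate for crux `TemporalBandLiouville.StationaryLimitReduction` (stmt-FinalStateConjecture-10173): (i) the Theses-free glue frame ascribes BY NAME to the glue item `StationaryLimitReductionOfSplit` (18041) and yields the crux from the three pieces; (ii) the suspect equivalence itself, kernel-checked for THIS decl: given the target X the crux is the summit, and the summit gives the crux outright. No sorry. -/

set_option linter.dupNamespace false
open scoped Manifold ContDiff

namespace Summit.FinalStateConjecture.FinalStateConjecture.Cruxes.StationaryLimitReduction.TemporalBandLiouvilleEquivalenceQ1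

theorem frame_proof :
    ((∀ (a r₀ : ℝ) (G : Literature.Geometry.Lorentzian.E4 → Literature.Geometry.Lorentzian.E4 →L[ℝ]
      Literature.Geometry.Lorentzian.E4 →L[ℝ] ℝ), (0 < r₀ ∧
      Literature.Geometry.Lorentzian.MetricCoord.IsMetricOn G
      (Literature.Geometry.Lorentzian.Kerr.region a r₀ : Set Literature.Geometry.Lorentzian.E4) ∧ (∃
      c₀ δ : ℝ, 0 < c₀ ∧ 0 < δ ∧ ∀ x ∈ Literature.Geometry.Lorentzian.Kerr.region a r₀,
      (Literature.Geometry.Lorentzian.E4.dx 0) (Literature.Geometry.Lorentzian.MetricCoord.sharpAt G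
      x (Literature.Geometry.Lorentzian.E4.dx 0)) ≤ -c₀ ∧
      (Literature.Geometry.Lorentzian.Kerr.radius a x < r₀ + δ → (fderiv ℝ
      (Literature.Geometry.Lorentzian.Kerr.radius a) x)
      (Literature.Geometry.Lorentzian.MetricCoord.sharpAt G x (fderiv ℝ
      (Literature.Geometry.Lorentzian.Kerr.radius a) x)) ≤ -c₀ ∧ c₀ ≤
      (Literature.Geometry.Lorentzian.E4.dx 0) (Literature.Geometry.Lorentzian.MetricCoord.sharpAt G
      x (fderiv ℝ (Literature.Geometry.Lorentzian.Kerr.radius a) x)))) ∧ (∀ x ∈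
      Literature.Geometry.Lorentzian.Kerr.region a r₀,
      Literature.Geometry.Lorentzian.MetricCoord.ricAt G x = 0) ∧ (∀ x ∈
      Literature.Geometry.Lorentzian.Kerr.region a r₀, ∑ β : Fin 4,
      Literature.Geometry.Lorentzian.MetricCoord.chrAt G x
      (Literature.Geometry.Lorentzian.MetricCoord.sharpAt G x (Literature.Geometry.Lorentzian.E4.dx
      β)) (Literature.Geometry.Lorentzian.E4.basisVector β) = 0) ∧ (∀ k : ℕ, ∃ C : ℝ, ∀ x ∈
      Literature.Geometry.Lorentzian.Kerr.region a r₀, ‖iteratedFDeriv ℝ k G x‖ ≤ C ∧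
      ‖Literature.Geometry.Lorentzian.MetricCoord.sharpAt G x‖ ≤ C) ∧ (∃ C : ℝ, ∀ x ∈
      Literature.Geometry.Lorentzian.Kerr.region a r₀, ‖G x -
      Literature.Geometry.Lorentzian.Minkowski.bilin‖ ≤ C /
      Literature.Geometry.Lorentzian.E4.spatialNorm x ∧ ‖iteratedFDeriv ℝ 1 G x‖ ≤ C /
      Literature.Geometry.Lorentzian.E4.spatialNorm x ^ 2 ∧ ‖iteratedFDeriv ℝ 2 G x‖ ≤ C /
      Literature.Geometry.Lorentzian.E4.spatialNorm x ^ 3)) → ∃ (M' a' : ℝ) (Ψ :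
      Literature.Geometry.Lorentzian.E4 → Literature.Geometry.Lorentzian.E4), 0 < M' ∧ |a'| ≤ M' ∧
      ContDiffOn ℝ (⊤ : ℕ∞) Ψ (Literature.Geometry.Lorentzian.Kerr.region a r₀ : Set
      Literature.Geometry.Lorentzian.E4) ∧ Set.InjOn Ψ (Literature.Geometry.Lorentzian.Kerr.region a
      r₀ : Set Literature.Geometry.Lorentzian.E4) ∧ (∀ x ∈
      Literature.Geometry.Lorentzian.Kerr.region a r₀, 0 <
      Literature.Geometry.Lorentzian.Kerr.radius a' (Ψ x)) ∧ ∀ x ∈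
      Literature.Geometry.Lorentzian.Kerr.region a r₀, ∀ v w : Literature.Geometry.Lorentzian.E4, G
      x v w = Literature.Geometry.Lorentzian.Kerr.bilin M' a' (Ψ x) (fderiv ℝ Ψ x v) (fderiv ℝ Ψ x
      w)) → ∀ (X : Type) [TopologicalSpace X] [ChartedSpace Literature.Geometry.Lorentzian.E3 X]
      [IsManifold (𝓡 3) (⊤ : ℕ∞) X] [T2Space X] [SecondCountableTopology X] [ConnectedSpace X], ∀ D
      ∈ Literature.Geometry.Lorentzian.admissibleVacuumData X, ∀ 𝒟 :
      Literature.Geometry.Lorentzian.VacuumCauchyDevelopment D, 𝒟.IsMaximal →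
      Summit.FinalStateConjecture.HasCompleteNullInfinity 𝒟.toCauchyDevelopment → ∃ (O : Set
      𝒟.carrier) (d : Literature.Geometry.Lorentzian.FinalStateDecomposition 𝒟.toSpacetime O 0), O =
      Summit.FinalStateConjecture.exteriorOf 𝒟.toCauchyDevelopment d.charted ∧
      Summit.FinalStateConjecture.RaysStayInClosure 𝒟.toCauchyDevelopment O ∧
      Summit.FinalStateConjecture.HasExhaustiveCharts d ∧
      Summit.FinalStateConjecture.IsFutureOriented d) →
    (∀ (a r₀ : ℝ) (G : Literature.Geometry.Lorentzian.E4 → Literature.Geometry.Lorentzian.E4 →L[ℝ]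
      Literature.Geometry.Lorentzian.E4 →L[ℝ] ℝ), (0 < r₀ ∧
      Literature.Geometry.Lorentzian.MetricCoord.IsMetricOn G
      (Literature.Geometry.Lorentzian.Kerr.region a r₀ : Set Literature.Geometry.Lorentzian.E4) ∧ (∃
      c₀ δ : ℝ, 0 < c₀ ∧ 0 < δ ∧ ∀ x ∈ Literature.Geometry.Lorentzian.Kerr.region a r₀,
      (Literature.Geometry.Lorentzian.E4.dx 0) (Literature.Geometry.Lorentzian.MetricCoord.sharpAt G
      x (Literature.Geometry.Lorentzian.E4.dx 0)) ≤ -c₀ ∧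
      (Literature.Geometry.Lorentzian.Kerr.radius a x < r₀ + δ → (fderiv ℝ
      (Literature.Geometry.Lorentzian.Kerr.radius a) x)
      (Literature.Geometry.Lorentzian.MetricCoord.sharpAt G x (fderiv ℝ
      (Literature.Geometry.Lorentzian.Kerr.radius a) x)) ≤ -c₀ ∧ c₀ ≤
      (Literature.Geometry.Lorentzian.E4.dx 0) (Literature.Geometry.Lorentzian.MetricCoord.sharpAt G
      x (fderiv ℝ (Literature.Geometry.Lorentzian.Kerr.radius a) x)))) ∧ (∀ x ∈
      Literature.Geometry.Lorentzian.Kerr.region a r₀,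
      Literature.Geometry.Lorentzian.MetricCoord.ricAt G x = 0) ∧ (∀ x ∈
      Literature.Geometry.Lorentzian.Kerr.region a r₀, ∑ β : Fin 4,
      Literature.Geometry.Lorentzian.MetricCoord.chrAt G x
      (Literature.Geometry.Lorentzian.MetricCoord.sharpAt G x (Literature.Geometry.Lorentzian.E4.dx
      β)) (Literature.Geometry.Lorentzian.E4.basisVector β) = 0) ∧ (∀ k : ℕ, ∃ C : ℝ, ∀ x ∈
      Literature.Geometry.Lorentzian.Kerr.region a r₀, ‖iteratedFDeriv ℝ k G x‖ ≤ C ∧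
      ‖Literature.Geometry.Lorentzian.MetricCoord.sharpAt G x‖ ≤ C) ∧ (∃ C : ℝ, ∀ x ∈
      Literature.Geometry.Lorentzian.Kerr.region a r₀, ‖G x -
      Literature.Geometry.Lorentzian.Minkowski.bilin‖ ≤ C /
      Literature.Geometry.Lorentzian.E4.spatialNorm x ∧ ‖iteratedFDeriv ℝ 1 G x‖ ≤ C /
      Literature.Geometry.Lorentzian.E4.spatialNorm x ^ 2 ∧ ‖iteratedFDeriv ℝ 2 G x‖ ≤ C /
      Literature.Geometry.Lorentzian.E4.spatialNorm x ^ 3)) → (∀ x ∈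
      Literature.Geometry.Lorentzian.Kerr.region a r₀, ∀ s : ℝ, G (x + s •
      Literature.Geometry.Lorentzian.E4.basisVector 0) = G x) → ∃ (M' a' : ℝ) (Ψ :
      Literature.Geometry.Lorentzian.E4 → Literature.Geometry.Lorentzian.E4), 0 < M' ∧ |a'| ≤ M' ∧
      ContDiffOn ℝ (⊤ : ℕ∞) Ψ (Literature.Geometry.Lorentzian.Kerr.region a r₀ : Set
      Literature.Geometry.Lorentzian.E4) ∧ Set.InjOn Ψ (Literature.Geometry.Lorentzian.Kerr.region a
      r₀ : Set Literature.Geometry.Lorentzian.E4) ∧ (∀ x ∈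
      Literature.Geometry.Lorentzian.Kerr.region a r₀, 0 <
      Literature.Geometry.Lorentzian.Kerr.radius a' (Ψ x)) ∧ ∀ x ∈
      Literature.Geometry.Lorentzian.Kerr.region a r₀, ∀ v w : Literature.Geometry.Lorentzian.E4, G
      x v w = Literature.Geometry.Lorentzian.Kerr.bilin M' a' (Ψ x) (fderiv ℝ Ψ x v) (fderiv ℝ Ψ x
      w)) →
    (∀ (X : Type) [TopologicalSpace X] [ChartedSpace Literature.Geometry.Lorentzian.E3 X]
      [IsManifold (𝓡 3) (⊤ : ℕ∞) X] [T2Space X] [SecondCountableTopology X] [ConnectedSpace X],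
      Literature.Geometry.Lorentzian.InitialDataSet.IsTameChristodoulouGeneric
      (Literature.Geometry.Lorentzian.admissibleVacuumData X) (fun D ↦ (∃ 𝒟 :
      Literature.Geometry.Lorentzian.VacuumCauchyDevelopment D, 𝒟.IsMaximal) ∧ ∀ 𝒟 :
      Literature.Geometry.Lorentzian.VacuumCauchyDevelopment D, 𝒟.IsMaximal →
      Summit.FinalStateConjecture.HasCompleteNullInfinity 𝒟.toCauchyDevelopment ∧ ∀ (O : Set
      𝒟.carrier) (d₀ : Literature.Geometry.Lorentzian.FinalStateDecomposition 𝒟.toSpacetime O 0), O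
      = Summit.FinalStateConjecture.exteriorOf 𝒟.toCauchyDevelopment d₀.charted →
      Summit.FinalStateConjecture.RaysStayInClosure 𝒟.toCauchyDevelopment O →
      Summit.FinalStateConjecture.HasExhaustiveCharts d₀ →
      Summit.FinalStateConjecture.IsFutureOriented d₀ → ∃ (O' : Set 𝒟.carrier) (d :
      Literature.Geometry.Lorentzian.FinalStateDecomposition 𝒟.toSpacetime O' 2), (∀ i,
      Literature.Geometry.Lorentzian.Kerr.IsSubextremal (d.mass i) (d.spin i)) ∧ O' =
      Summit.FinalStateConjecture.exteriorOf 𝒟.toCauchyDevelopment d.charted ∧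
      Summit.FinalStateConjecture.RaysStayInClosure 𝒟.toCauchyDevelopment O' ∧
      Summit.FinalStateConjecture.HasExhaustiveCharts d ∧
      Summit.FinalStateConjecture.IsFutureOriented d) 1) →
    (∀ (a r₀ : ℝ) (G : Literature.Geometry.Lorentzian.E4 → Literature.Geometry.Lorentzian.E4 →L[ℝ]
      Literature.Geometry.Lorentzian.E4 →L[ℝ] ℝ), (0 < r₀ ∧
      Literature.Geometry.Lorentzian.MetricCoord.IsMetricOn G
      (Literature.Geometry.Lorentzian.Kerr.region a r₀ : Set Literature.Geometry.Lorentzian.E4) ∧ (∃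
      c₀ δ : ℝ, 0 < c₀ ∧ 0 < δ ∧ ∀ x ∈ Literature.Geometry.Lorentzian.Kerr.region a r₀,
      (Literature.Geometry.Lorentzian.E4.dx 0) (Literature.Geometry.Lorentzian.MetricCoord.sharpAt G
      x (Literature.Geometry.Lorentzian.E4.dx 0)) ≤ -c₀ ∧
      (Literature.Geometry.Lorentzian.Kerr.radius a x < r₀ + δ → (fderiv ℝ
      (Literature.Geometry.Lorentzian.Kerr.radius a) x)
      (Literature.Geometry.Lorentzian.MetricCoord.sharpAt G x (fderiv ℝ
      (Literature.Geometry.Lorentzian.Kerr.radius a) x)) ≤ -c₀ ∧ c₀ ≤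
      (Literature.Geometry.Lorentzian.E4.dx 0) (Literature.Geometry.Lorentzian.MetricCoord.sharpAt G
      x (fderiv ℝ (Literature.Geometry.Lorentzian.Kerr.radius a) x)))) ∧ (∀ x ∈
      Literature.Geometry.Lorentzian.Kerr.region a r₀,
      Literature.Geometry.Lorentzian.MetricCoord.ricAt G x = 0) ∧ (∀ x ∈
      Literature.Geometry.Lorentzian.Kerr.region a r₀, ∑ β : Fin 4,
      Literature.Geometry.Lorentzian.MetricCoord.chrAt G x
      (Literature.Geometry.Lorentzian.MetricCoord.sharpAt G x (Literature.Geometry.Lorentzian.E4.dx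
      β)) (Literature.Geometry.Lorentzian.E4.basisVector β) = 0) ∧ (∀ k : ℕ, ∃ C : ℝ, ∀ x ∈
      Literature.Geometry.Lorentzian.Kerr.region a r₀, ‖iteratedFDeriv ℝ k G x‖ ≤ C ∧
      ‖Literature.Geometry.Lorentzian.MetricCoord.sharpAt G x‖ ≤ C) ∧ (∃ C : ℝ, ∀ x ∈
      Literature.Geometry.Lorentzian.Kerr.region a r₀, ‖G x -
      Literature.Geometry.Lorentzian.Minkowski.bilin‖ ≤ C /
      Literature.Geometry.Lorentzian.E4.spatialNorm x ∧ ‖iteratedFDeriv ℝ 1 G x‖ ≤ C /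
      Literature.Geometry.Lorentzian.E4.spatialNorm x ^ 2 ∧ ‖iteratedFDeriv ℝ 2 G x‖ ≤ C /
      Literature.Geometry.Lorentzian.E4.spatialNorm x ^ 3)) → ∀ x ∈
      Literature.Geometry.Lorentzian.Kerr.region a r₀, ∀ s : ℝ, G (x + s •
      Literature.Geometry.Lorentzian.E4.basisVector 0) = G x) →
      _root_.FinalStateConjecture := by
  intro h₁ h₂ h₃ hX X i₁ i₂ i₃ i₄ i₅ i₆
  -- every member of X's class is t-independent (X) hence Kerr (P2); P1 then gives T
  have hT := h₁ (fun a r₀ G h => h₂ a r₀ G h (hX a r₀ G h))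
  -- TAME Christodoulou-genericity (codimension 1, one fixed end) is monotone in the property
  have mono : ∀ {P Q : _ → Prop},
      (∀ D ∈ Literature.Geometry.Lorentzian.admissibleVacuumData X, Q D → P D) →
      Literature.Geometry.Lorentzian.InitialDataSet.IsTameChristodoulouGeneric
        (Literature.Geometry.Lorentzian.admissibleVacuumData X) Q 1 →
      Literature.Geometry.Lorentzian.InitialDataSet.IsTameChristodoulouGeneric
        (Literature.Geometry.Lorentzian.admissibleVacuumData X) P 1 := by
    intro P Q hQP hQ D hD
    obtain ⟨e, F, htame, himm, h0, hinj, hadm, hexc⟩ :=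
      hQ D ⟨hD.1, fun h => hD.2 (hQP D hD.1 h)⟩
    exact ⟨e, F, htame, himm, h0, hinj, hadm,
      fun c hc hmem => hexc c hc ⟨hmem.1, fun h => hmem.2 (hQP _ hmem.1 h)⟩⟩
  refine mono ?_ (h₃ X)
  intro D hD hQ
  obtain ⟨hex, hQ'⟩ := hQ
  refine ⟨hex, fun 𝒟 hmax => ?_⟩
  obtain ⟨hcomp, hup⟩ := hQ' 𝒟 hmax
  obtain ⟨O, d₀, hO, hrays, hexh, hfut⟩ := hT X D hD 𝒟 hmax hcomp
  obtain ⟨O', d, hsub, hO', hrays', hexh', hfut'⟩ := hup O d₀ hO hrays hexh hfut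
  exact ⟨hcomp, O', d, hsub, hO', hrays', hexh', hfut'⟩


open Summit.FinalStateConjecture.FinalStateConjecture.Theses.TemporalBandLiouville in
/-- δ-unfolds to the route decl `StationaryLimitReductionOfSplit` (item 18041). -/
theorem glue_by_name : StationaryLimitReductionOfSplit := frame_proof

open Summit.FinalStateConjecture.FinalStateConjecture.Theses.TemporalBandLiouville in
/-- The crux from the three pieces, by name. -/
theorem crux_of_pieces (h₁ : KerrExteriorsSettle) (h₂ : StationaryHarmonicExteriorIsKerr)
    (h₃ : GenericCensoredCapture) : StationaryLimitReduction := frame_proof h₁ h₂ h₃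

open Summit.FinalStateConjecture.FinalStateConjecture.Theses.TemporalBandLiouville in
/-- The suspect equivalence itself, for the record: given X the crux IS the summit (one line). -/
theorem crux_iff_summit_of_target (hX : EternalExteriorStationary) :
    StationaryLimitReduction ↔ _root_.FinalStateConjecture := ⟨fun h ↦ h hX, fun h _ ↦ h⟩

/-- And unconditionally the summit implies the crux. -/
theorem crux_of_summit (h : _root_.FinalStateConjecture) :
    Summit.FinalStateConjecture.FinalStateConjecture.Theses.TemporalBandLiouville.StationaryLimitReduction :=
  fun _ ↦ h

end Summit.FinalStateConjecture.FinalStateConjecture.Cruxes.StationaryLimitReduction.TemporalBandLiouvilleEquivalenceQ1
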